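import Summits.NavierStokesRegularity.NavierStokesRegularity.Theorems.EulerZoomLiouvillePowerGaugeEulerLiouvilleClassicalProfilePoisson

/-!
# Crux `EulerZoomLiouville.PowerGaugeEulerLiouville` (stmt-NavierStokesRegularity-19832), line `logtime-breathers`:
# the CLASSICAL local energy equality and pressure–Poisson equation of a generalised profile equation

Width seat `ns-ezl-w4` (breather rigidity, file II: the local energy equality and the scale ODE; sequel of
`…ClassicalProfilePoisson`).  Let `V : ℝ³ → ℝ³`, `P : ℝ³ → ℝ` be `C¹`, `div V = 0`, and
suppose the GENERALISED PROFILE EQUATION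
`α V + β (y·∇)V + (V·∇)V + ∇P = 0`                                                      (PE_{α,β})
holds pointwise (`(y·∇)V(y) = DV(y)[y]`).  The power clock of rate `γ` is `(α, β) = (1 − γ, γ)`
(Constantin–Ignatova–Vicol (3.3)); the LOG-TIME BREATHER `u(τ,y) = e^{cτ} V(e^{−cτ}y)` is `(α, β) = (c, −c)`
(`ClockRigidity.profile_identity` with `θ = ℓ = e^{cτ}`), which NO power clock realises.  By whole-space
integration by parts (`Literature.Analysis.FluidPDE.WholeSpaceIBP`):

* `pressure_poisson` — `∫ P Δθ = −∫ D²θ(V, V)` for every `θ ∈ C²_c` (pair (PE) with `∇θ`: the linear terms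
  drop out because `V` and `(y·∇)V − V`… are divergence free, `∫⟪(V·∇)V, ∇θ⟫ = −∫D²θ(V,V)`);
* `local_energy_equality` — `(2α − 3β) ∫ σ|V|² = ∫ (|V|² + 2P)⟪V, ∇σ⟫ + β ∫ |V|²⟪y, ∇σ⟫` for every
  `σ ∈ C¹_c` (pair (PE) with `σV`); for `(1−γ, γ)` this is the classical case of
  `ProfileEnergy.profile_local_energy_equality`, for the breather it reads `5c N_σ + c X_σ = F_σ`;
* `hasDerivAt_rpow_mul_cutoffEnergy`, `rpow_mul_cutoffEnergy_sub_eq` — the scale ODE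
  `(L^κ N_σ(L))' = β⁻¹ L^{κ−1} F_σ(L)` (`κβ = 2α − 3β`, `N_σ(L) = ∫σ(L⁻¹y)|V|²`) and its integrated form,
  the `κ = 2ρ − 1` case being the tree's `EnergySaturation.hasDerivAt_normEnergy_of_energyEquality`;
  for the breather `κ = −5`.

WHAT THIS IS NOT: not NS regularity, not the crux — calculus for the breather-rigidity member of line
`logtime-breathers` (T2/T3); `--supports` stmt-19832. [folklore]
-/

noncomputable section

set_option linter.dupNamespace false

open MeasureTheory Set Filter Topology Metric Function TopologicalSpace
open scoped ENNReal NNReal RealInnerProductSpace ContDiff Laplacian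

namespace Summit.NavierStokesRegularity.NavierStokesRegularity.Theorems.PowerGaugeEulerLiouville

open Literature.Analysis Literature.Analysis.FunctionSpaces Literature.Analysis.FluidPDE

namespace ClassicalProfile

variable {V : EuclideanSpace ℝ (Fin 3) → EuclideanSpace ℝ (Fin 3)} {P σ θ : EuclideanSpace ℝ (Fin 3) → ℝ}

/-! ## The local energy equality of a classical generalised profile -/

/-- `∫ σ⟪(V·∇)V, V⟫ = −½ ∫ |V|²⟪V, ∇σ⟫` for `V ∈ C¹` divergence free, `σ ∈ C¹_c`. [folklore] -/
theorem integral_mul_inner_convect (hV : ContDiff ℝ 1 V) (hdiv : VectorCalculus.IsDivFree V)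
    (hσ : ContDiff ℝ 1 σ) (hσc : HasCompactSupport σ) :
    ∫ x, σ x * ⟪fderiv ℝ V x (V x), V x⟫ = -(1 / 2) * ∫ x, ‖V x‖ ^ 2 * ⟪V x, gradient σ x⟫ := by
  have hw : ContDiff ℝ 1 (fun x => σ x • V x) := hσ.smul hV
  have hwc : HasCompactSupport (fun x => σ x • V x) := hσc.smul_right
  have h := integral_inner_convect_add_eq_zero hV hV hw hwc
  simp only [convect_apply, hdiv _, zero_mul, integral_zero, add_zero] at h
  have hσd : ∀ x, DifferentiableAt ℝ σ x := fun x => hσ.differentiable one_ne_zero x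
  have hVd : ∀ x, DifferentiableAt ℝ V x := fun x => hV.differentiable one_ne_zero x
  have e1 : ∫ x, ⟪fderiv ℝ V x (V x), σ x • V x⟫ = ∫ x, σ x * ⟪fderiv ℝ V x (V x), V x⟫ :=
    integral_congr_ae (Eventually.of_forall fun x => by
      show ⟪fderiv ℝ V x (V x), σ x • V x⟫ = σ x * ⟪fderiv ℝ V x (V x), V x⟫
      rw [real_inner_smul_right])
  have hi1 : Integrable (fun x => σ x * ⟪fderiv ℝ V x (V x), V x⟫) volume :=
    (hσ.continuous.mul (((hV.continuous_fderiv one_ne_zero).clm_apply hV.continuous).inner hV.continuous))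
      |>.integrable_of_hasCompactSupport hσc.mul_right
  have hi2 : Integrable (fun x => ‖V x‖ ^ 2 * ⟪V x, gradient σ x⟫) volume :=
    integrable_mul_inner_gradient_of_continuous (hV.continuous.norm.pow 2) hV.continuous hσ hσc
  have e2 : ∫ x, ⟪V x, fderiv ℝ (fun y => σ y • V y) x (V x)⟫ =
      (∫ x, σ x * ⟪fderiv ℝ V x (V x), V x⟫) + ∫ x, ‖V x‖ ^ 2 * ⟪V x, gradient σ x⟫ := by
    rw [← integral_add hi1 hi2]
    refine integral_congr_ae (Eventually.of_forall fun x => ?_)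
    show ⟪V x, fderiv ℝ (fun y => σ y • V y) x (V x)⟫ =
      σ x * ⟪fderiv ℝ V x (V x), V x⟫ + ‖V x‖ ^ 2 * ⟪V x, gradient σ x⟫
    have hc := convect_smul_apply (u := V) (hσd x) (hVd x)
    simp only [convect_apply] at hc
    rw [hc, inner_add_right, real_inner_smul_right, real_inner_smul_right, real_inner_self_eq_norm_sq,
      real_inner_comm (fderiv ℝ V x (V x)) (V x), real_inner_comm (gradient σ x) (V x), FluidPDE.inner_gradient_left]
    ring
  rw [e1, e2] at h
  linarith

/-- `∫ σ⟪(y·∇)V, V⟫ = −(3/2) ∫ σ|V|² − ½ ∫ |V|²⟪y, ∇σ⟫` for `V ∈ C¹`, `σ ∈ C¹_c`. [folklore] -/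
theorem integral_mul_inner_fderiv_self (hV : ContDiff ℝ 1 V) (hσ : ContDiff ℝ 1 σ) (hσc : HasCompactSupport σ) :
    ∫ x, σ x * ⟪fderiv ℝ V x x, V x⟫ =
      -(3 / 2) * (∫ x, σ x * ‖V x‖ ^ 2) - (1 / 2) * ∫ x, ‖V x‖ ^ 2 * ⟪x, gradient σ x⟫ := by
  have hid : ContDiff ℝ 1 (fun y : EuclideanSpace ℝ (Fin 3) => y) := contDiff_id
  have hw : ContDiff ℝ 1 (fun x => σ x • V x) := hσ.smul hV
  have hwc : HasCompactSupport (fun x => σ x • V x) := hσc.smul_right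
  have h := integral_inner_convect_add_eq_zero hid hV hw hwc
  simp only [convect_apply, Sverak2011.divergence_id_three] at h
  have hσd : ∀ x, DifferentiableAt ℝ σ x := fun x => hσ.differentiable one_ne_zero x
  have hVd : ∀ x, DifferentiableAt ℝ V x := fun x => hV.differentiable one_ne_zero x
  have e1 : ∫ x, ⟪fderiv ℝ V x x, σ x • V x⟫ = ∫ x, σ x * ⟪fderiv ℝ V x x, V x⟫ :=
    integral_congr_ae (Eventually.of_forall fun x => by
      show ⟪fderiv ℝ V x x, σ x • V x⟫ = σ x * ⟪fderiv ℝ V x x, V x⟫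
      rw [real_inner_smul_right])
  have hi1 : Integrable (fun x => σ x * ⟪fderiv ℝ V x x, V x⟫) volume :=
    (hσ.continuous.mul (((hV.continuous_fderiv one_ne_zero).clm_apply continuous_id).inner hV.continuous))
      |>.integrable_of_hasCompactSupport hσc.mul_right
  have hi2 : Integrable (fun x => ‖V x‖ ^ 2 * ⟪x, gradient σ x⟫) volume :=
    integrable_mul_inner_gradient_of_continuous (hV.continuous.norm.pow 2) continuous_id hσ hσc
  have hi3 : Integrable (fun x => σ x * ‖V x‖ ^ 2) volume :=
    (hσ.continuous.mul (hV.continuous.norm.pow 2)).integrable_of_hasCompactSupport hσc.mul_right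
  have e2 : ∫ x, ⟪V x, fderiv ℝ (fun y => σ y • V y) x x⟫ =
      (∫ x, σ x * ⟪fderiv ℝ V x x, V x⟫) + ∫ x, ‖V x‖ ^ 2 * ⟪x, gradient σ x⟫ := by
    rw [← integral_add hi1 hi2]
    refine integral_congr_ae (Eventually.of_forall fun x => ?_)
    show ⟪V x, fderiv ℝ (fun y => σ y • V y) x x⟫ = σ x * ⟪fderiv ℝ V x x, V x⟫ + ‖V x‖ ^ 2 * ⟪x, gradient σ x⟫
    have hc := convect_smul_apply (u := fun y : EuclideanSpace ℝ (Fin 3) => y) (hσd x) (hVd x)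
    simp only [convect_apply] at hc
    rw [hc, inner_add_right, real_inner_smul_right, real_inner_smul_right, real_inner_self_eq_norm_sq,
      real_inner_comm (fderiv ℝ V x x) (V x), real_inner_comm (gradient σ x) x, FluidPDE.inner_gradient_left]
    ring
  have e3 : ∫ x, (3 : ℝ) * ⟪V x, σ x • V x⟫ = 3 * ∫ x, σ x * ‖V x‖ ^ 2 := by
    rw [← integral_const_mul]
    refine integral_congr_ae (Eventually.of_forall fun x => ?_)
    show (3 : ℝ) * ⟪V x, σ x • V x⟫ = 3 * (σ x * ‖V x‖ ^ 2)
    rw [real_inner_smul_right, real_inner_self_eq_norm_sq]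
  rw [e1, e2, e3] at h
  linarith

/-- `∫ σ⟪∇P, V⟫ = −∫ P⟪V, ∇σ⟫` for `P, V ∈ C¹`, `div V = 0`, `σ ∈ C¹_c`. [folklore] -/
theorem integral_mul_inner_gradient (hP : ContDiff ℝ 1 P) (hV : ContDiff ℝ 1 V) (hdiv : VectorCalculus.IsDivFree V)
    (hσ : ContDiff ℝ 1 σ) (hσc : HasCompactSupport σ) :
    ∫ x, σ x * ⟪gradient P x, V x⟫ = -∫ x, P x * ⟪V x, gradient σ x⟫ := by
  have h := integral_inner_gradient_eq_neg_integral_mul_divergence (ψ := fun x => σ x • V x) hP (hσ.smul hV)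
    hσc.smul_right
  have e1 : ∫ x, ⟪gradient P x, σ x • V x⟫ = ∫ x, σ x * ⟪gradient P x, V x⟫ :=
    integral_congr_ae (Eventually.of_forall fun x => by
      show ⟪gradient P x, σ x • V x⟫ = σ x * ⟪gradient P x, V x⟫
      rw [real_inner_smul_right])
  have e2 : ∫ x, P x * VectorCalculus.divergence (fun y => σ y • V y) x = ∫ x, P x * ⟪V x, gradient σ x⟫ :=
    integral_congr_ae (Eventually.of_forall fun x => by
      show P x * VectorCalculus.divergence (fun y => σ y • V y) x = P x * ⟪V x, gradient σ x⟫
      rw [divergence_smul_apply (hσ.differentiable one_ne_zero x) (hV.differentiable one_ne_zero x), hdiv x,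
        mul_zero, zero_add])
  rw [← e1, h, e2]

/-- **LOCAL ENERGY EQUALITY of the generalised profile equation, classical form.**  If `V, P ∈ C¹`,
`div V = 0` and `α V + β (y·∇)V + (V·∇)V + ∇P = 0` pointwise, then for every `σ ∈ C¹_c`
`(2α − 3β) ∫ σ|V|² = ∫ (|V|² + 2P)⟪V, ∇σ⟫ + β ∫ |V|²⟪y, ∇σ⟫`.
For `(α, β) = (1−γ, γ)` this is `ProfileEnergy.profile_local_energy_equality` (classical case); for the
log-time breather `(c, −c)`: `5c ∫σ|V|² = ∫(|V|²+2P)⟪V,∇σ⟫ − c∫|V|²⟪y,∇σ⟫`. [folklore] -/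
theorem local_energy_equality (hV : ContDiff ℝ 1 V) (hP : ContDiff ℝ 1 P) (hdiv : VectorCalculus.IsDivFree V)
    {α β : ℝ} (heq : ∀ x, α • V x + β • fderiv ℝ V x x + fderiv ℝ V x (V x) + gradient P x = 0)
    (hσ : ContDiff ℝ 1 σ) (hσc : HasCompactSupport σ) :
    (2 * α - 3 * β) * ∫ x, σ x * ‖V x‖ ^ 2 =
      (∫ x, (‖V x‖ ^ 2 + 2 * P x) * ⟪V x, gradient σ x⟫) + β * ∫ x, ‖V x‖ ^ 2 * ⟪x, gradient σ x⟫ := by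
  -- pointwise pairing of the equation with `σ V`
  have hpt : ∀ x, σ x * ⟪fderiv ℝ V x (V x), V x⟫ + σ x * ⟪gradient P x, V x⟫ =
      -(α * (σ x * ‖V x‖ ^ 2)) - β * (σ x * ⟪fderiv ℝ V x x, V x⟫) := by
    intro x
    have h := congrArg (fun w => σ x * ⟪w, V x⟫) (heq x)
    simp only [inner_add_left, inner_smul_left, inner_zero_left, RCLike.conj_to_real, real_inner_self_eq_norm_sq,
      mul_zero] at h
    linarith
  have hDV : Continuous (fderiv ℝ V) := hV.continuous_fderiv one_ne_zero
  have hiC : Integrable (fun x => σ x * ⟪fderiv ℝ V x (V x), V x⟫) volume :=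
    (hσ.continuous.mul ((hDV.clm_apply hV.continuous).inner hV.continuous)).integrable_of_hasCompactSupport
      hσc.mul_right
  have hiP : Integrable (fun x => σ x * ⟪gradient P x, V x⟫) volume :=
    (hσ.continuous.mul ((continuous_gradient_of_contDiff hP).inner hV.continuous)).integrable_of_hasCompactSupport
      hσc.mul_right
  have hiN : Integrable (fun x => σ x * ‖V x‖ ^ 2) volume :=
    (hσ.continuous.mul (hV.continuous.norm.pow 2)).integrable_of_hasCompactSupport hσc.mul_right
  have hiS : Integrable (fun x => σ x * ⟪fderiv ℝ V x x, V x⟫) volume :=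
    (hσ.continuous.mul ((hDV.clm_apply continuous_id).inner hV.continuous)).integrable_of_hasCompactSupport
      hσc.mul_right
  have hint : (∫ x, σ x * ⟪fderiv ℝ V x (V x), V x⟫) + ∫ x, σ x * ⟪gradient P x, V x⟫ =
      -(α * ∫ x, σ x * ‖V x‖ ^ 2) - β * ∫ x, σ x * ⟪fderiv ℝ V x x, V x⟫ := by
    rw [← integral_add hiC hiP, ← integral_const_mul, ← integral_const_mul, ← integral_neg, ← integral_sub]
    · exact integral_congr_ae (Eventually.of_forall fun x => by simp only [hpt x])
    · exact (hiN.const_mul α).neg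
    · exact hiS.const_mul β
  rw [integral_mul_inner_convect hV hdiv hσ hσc, integral_mul_inner_gradient hP hV hdiv hσ hσc,
    integral_mul_inner_fderiv_self hV hσ hσc] at hint
  -- split `∫ (|V|²+2P)⟪V,∇σ⟫`
  have hi2 : Integrable (fun x => ‖V x‖ ^ 2 * ⟪V x, gradient σ x⟫) volume :=
    integrable_mul_inner_gradient_of_continuous (hV.continuous.norm.pow 2) hV.continuous hσ hσc
  have hi4 : Integrable (fun x => P x * ⟪V x, gradient σ x⟫) volume :=
    integrable_mul_inner_gradient_of_continuous hP.continuous hV.continuous hσ hσc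
  have hF : ∫ x, (‖V x‖ ^ 2 + 2 * P x) * ⟪V x, gradient σ x⟫ =
      (∫ x, ‖V x‖ ^ 2 * ⟪V x, gradient σ x⟫) + 2 * ∫ x, P x * ⟪V x, gradient σ x⟫ := by
    rw [← integral_const_mul, ← integral_add hi2 (hi4.const_mul 2)]
    refine integral_congr_ae (Eventually.of_forall fun x => ?_)
    simp only
    ring
  rw [hF]
  linarith

/-! ## The scale ODE of the cut-off energy -/

/-- **The scale ODE.**  Let `σ` be a test function, `V ∈ L²_loc`, `β ≠ 0`, and suppose the local energy
equality of the generalised profile equation holds for the dilated cut-off `σ_L = σ(L⁻¹·)` at the scale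
`L > 0` with `2α − 3β = κβ`:  `κβ ∫σ_L|V|² = F_σ(L) + β ∫|V|²⟪y,∇σ_L⟫`, `F_σ(L) = ∫(|V|²+2P)⟪V,∇σ_L⟫`.  Then
`d/dL [L^κ ∫σ(L⁻¹y)|V|²] = β⁻¹ L^{κ−1} F_σ(L)`.  (`κ = 2ρ−1`, `β = 1/(2+ρ)`:
`EnergySaturation.hasDerivAt_normEnergy_of_energyEquality`; breather: `κ = −5`, `β = −c`.) [folklore] -/
theorem hasDerivAt_rpow_mul_cutoffEnergy {κ β : ℝ} (hβ : β ≠ 0)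
    (hσ : IsTestFunctionOn (⊤ : Opens (EuclideanSpace ℝ (Fin 3))) σ)
    (hVm : AEStronglyMeasurable V volume)
    (hV2 : LocallyIntegrable (fun y => ‖V y‖ ^ 2) volume)
    {L : ℝ} (hL : 0 < L)
    (hEE : κ * β * ∫ x, σ (L⁻¹ • x) * ‖V x‖ ^ 2 =
      (∫ x, (‖V x‖ ^ 2 + 2 * P x) * ⟪V x, gradient (fun z => σ (L⁻¹ • z)) x⟫) +
        β * ∫ x, ‖V x‖ ^ 2 * ⟪x, gradient (fun z => σ (L⁻¹ • z)) x⟫) :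
    HasDerivAt (fun L : ℝ => L ^ κ * ∫ y, σ (L⁻¹ • y) * ‖V y‖ ^ 2)
      (β⁻¹ * L ^ (κ - 1) *
        ∫ x, (‖V x‖ ^ 2 + 2 * P x) * ⟪V x, gradient (fun z => σ (L⁻¹ • z)) x⟫) L := by
  have hσ1 : ContDiff ℝ 1 σ := hσ.contDiff.of_le (by norm_cast)
  have hσd : Differentiable ℝ σ := hσ1.differentiable one_ne_zero
  obtain ⟨-, hI⟩ := EnergySaturation.hasDerivAt_cutoffEnergy hσ1 hσ.hasCompactSupport hVm hV2 hL
  have hpow : HasDerivAt (fun L : ℝ => L ^ κ) (κ * L ^ (κ - 1)) L :=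
    Real.hasDerivAt_rpow_const (Or.inl hL.ne')
  have hprod := hpow.mul hI
  refine hprod.congr_deriv ?_
  have heuler : ∫ x, ‖V x‖ ^ 2 * ⟪x, gradient (fun z => σ (L⁻¹ • z)) x⟫ =
      -L * ∫ y, (-(L ^ 2)⁻¹ * fderiv ℝ σ (L⁻¹ • y) y) * ‖V y‖ ^ 2 := by
    rw [← integral_const_mul]
    refine integral_congr_ae (Eventually.of_forall fun y => ?_)
    show ‖V y‖ ^ 2 * ⟪y, gradient (fun z => σ (L⁻¹ • z)) y⟫ =
      -L * (-(L ^ 2)⁻¹ * fderiv ℝ σ (L⁻¹ • y) y * ‖V y‖ ^ 2)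
    rw [EnergySaturation.inner_self_gradient_comp_inv_smul hσd, map_smul, smul_eq_mul]
    field_simp
  have hflux : (∫ x, (‖V x‖ ^ 2 + 2 * P x) * ⟪V x, gradient (fun z => σ (L⁻¹ • z)) x⟫) =
      κ * β * (∫ x, σ (L⁻¹ • x) * ‖V x‖ ^ 2) -
        β * (-L * ∫ y, (-(L ^ 2)⁻¹ * fderiv ℝ σ (L⁻¹ • y) y) * ‖V y‖ ^ 2) := by
    rw [← heuler]; linarith
  rw [hflux]
  have e2 : L ^ κ = L ^ (κ - 1) * L := by
    rw [show κ = (κ - 1) + 1 by ring, Real.rpow_add hL, Real.rpow_one]; ring_nf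
  rw [e2]
  field_simp
  ring

/-- **The integrated scale identity.**  Under the hypotheses of `hasDerivAt_rpow_mul_cutoffEnergy` at every
scale `L > 0`, for `0 < L₁ ≤ L₂`:
`L₂^κ ∫σ(L₂⁻¹y)|V|² − L₁^κ ∫σ(L₁⁻¹y)|V|² = ∫_{L₁}^{L₂} β⁻¹ r^{κ−1} F_σ(r) dr`. [folklore] -/
theorem rpow_mul_cutoffEnergy_sub_eq {κ β : ℝ} (hβ : β ≠ 0)
    (hσ : IsTestFunctionOn (⊤ : Opens (EuclideanSpace ℝ (Fin 3))) σ)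
    (hVm : AEStronglyMeasurable V volume)
    (hV2 : LocallyIntegrable (fun y => ‖V y‖ ^ 2) volume)
    (hEE : ∀ L : ℝ, 0 < L → κ * β * ∫ x, σ (L⁻¹ • x) * ‖V x‖ ^ 2 =
      (∫ x, (‖V x‖ ^ 2 + 2 * P x) * ⟪V x, gradient (fun z => σ (L⁻¹ • z)) x⟫) +
        β * ∫ x, ‖V x‖ ^ 2 * ⟪x, gradient (fun z => σ (L⁻¹ • z)) x⟫)
    {L₁ L₂ : ℝ} (hL₁ : 0 < L₁) (h12 : L₁ ≤ L₂) :
    L₂ ^ κ * (∫ y, σ (L₂⁻¹ • y) * ‖V y‖ ^ 2) - L₁ ^ κ * (∫ y, σ (L₁⁻¹ • y) * ‖V y‖ ^ 2) =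
      ∫ r in L₁..L₂, β⁻¹ * r ^ (κ - 1) *
        ∫ x, (‖V x‖ ^ 2 + 2 * P x) * ⟪V x, gradient (fun z => σ (r⁻¹ • z)) x⟫ := by
  have hσ1 : ContDiff ℝ 1 σ := hσ.contDiff.of_le (by norm_cast)
  have hderiv : ∀ r ∈ uIcc L₁ L₂, HasDerivAt (fun L : ℝ => L ^ κ * ∫ y, σ (L⁻¹ • y) * ‖V y‖ ^ 2)
      (β⁻¹ * r ^ (κ - 1) *
        ∫ x, (‖V x‖ ^ 2 + 2 * P x) * ⟪V x, gradient (fun z => σ (r⁻¹ • z)) x⟫) r := by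
    intro r hr
    rw [uIcc_of_le h12] at hr
    have hr0 : 0 < r := lt_of_lt_of_le hL₁ hr.1
    exact hasDerivAt_rpow_mul_cutoffEnergy hβ hσ hVm hV2 hr0 (hEE r hr0)
  have hcontI : ContinuousOn (fun L : ℝ => ∫ y, σ (L⁻¹ • y) * ‖V y‖ ^ 2) (Icc L₁ L₂) :=
    fun r hr => (EnergySaturation.hasDerivAt_cutoffEnergy hσ1 hσ.hasCompactSupport hVm hV2
      (lt_of_lt_of_le hL₁ hr.1)).2.continuousAt.continuousWithinAt
  have hcontI' : ContinuousOn
      (fun L : ℝ => ∫ y, (-(L ^ 2)⁻¹ * fderiv ℝ σ (L⁻¹ • y) y) * ‖V y‖ ^ 2) (Icc L₁ L₂) :=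
    fun r hr => (EnergySaturation.continuousAt_cutoffEnergyDeriv hσ1 hσ.hasCompactSupport hVm hV2
      (lt_of_lt_of_le hL₁ hr.1)).continuousWithinAt
  have hpow1 : ContinuousOn (fun L : ℝ => L ^ (κ - 1)) (Icc L₁ L₂) := fun r hr =>
    (Real.continuousAt_rpow_const _ _ (Or.inl (lt_of_lt_of_le hL₁ hr.1).ne')).continuousWithinAt
  have hpow2 : ContinuousOn (fun L : ℝ => L ^ κ) (Icc L₁ L₂) := fun r hr =>
    (Real.continuousAt_rpow_const _ _ (Or.inl (lt_of_lt_of_le hL₁ hr.1).ne')).continuousWithinAt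
  have hcont : ContinuousOn (fun r : ℝ => β⁻¹ * r ^ (κ - 1) *
      ∫ x, (‖V x‖ ^ 2 + 2 * P x) * ⟪V x, gradient (fun z => σ (r⁻¹ • z)) x⟫) (Icc L₁ L₂) := by
    have hexpr : ContinuousOn (fun L : ℝ => κ * L ^ (κ - 1) * (∫ y, σ (L⁻¹ • y) * ‖V y‖ ^ 2)
        + L ^ κ * ∫ y, (-(L ^ 2)⁻¹ * fderiv ℝ σ (L⁻¹ • y) y) * ‖V y‖ ^ 2) (Icc L₁ L₂) :=
      ((continuousOn_const.mul hpow1).mul hcontI).add (hpow2.mul hcontI')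
    refine hexpr.congr fun r hr => ?_
    have hr0 : 0 < r := lt_of_lt_of_le hL₁ hr.1
    have hd1 := hasDerivAt_rpow_mul_cutoffEnergy hβ hσ hVm hV2 hr0 (hEE r hr0)
    have hpow : HasDerivAt (fun L : ℝ => L ^ κ) (κ * r ^ (κ - 1)) r :=
      Real.hasDerivAt_rpow_const (Or.inl hr0.ne')
    have hd2 := hpow.mul (EnergySaturation.hasDerivAt_cutoffEnergy hσ1 hσ.hasCompactSupport hVm hV2 hr0).2
    exact hd1.unique hd2
  rw [intervalIntegral.integral_eq_sub_of_hasDerivAt hderiv (hcont.intervalIntegrable_of_Icc h12)]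

end ClassicalProfile

end Summit.NavierStokesRegularity.NavierStokesRegularity.Theorems.PowerGaugeEulerLiouville

end
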